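import Literature.AlgebraicTopology.CharacteristicClasses.ProjectiveBundleGaussClass
import Literature.AlgebraicTopology.CharacteristicClasses.ChernClassUniquenessLineBundles
import Literature.AlgebraicTopology.CharacteristicClasses.ProjectiveBundleSplittingIso
import Literature.AlgebraicTopology.SingularHomology.LerayHirschCovers
import Literature.Topology.DisjointCountableRefinement
import HarnessLib

/-!
# Uniqueness of Chern classes: Husemoller's Theorem 5.4, proved

Topic `Literature/AlgebraicTopology/CharacteristicClasses`. D. Husemoller, *Fibre Bundles*, 3rd
ed. (1994), Ch. 17 Thm. 5.4: "The properties (C₀) to (C₃) completely determine the Chern classes."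
Proof (loc. cit.): by the splitting principle — over the projective bundle `q : E(Pξ) → B` the
bundle `q*ξ` splits off the canonical line bundle (Prop. 5.2) and `q*` is a monomorphism (Thm. 2.5,
from the Leray–Hirsch theorem 1.1 and the cohomology of the fibre `ℂPⁿ⁻¹`, (2.3)) — one reduces
to line bundles, which are classified by maps to `ℂP^∞` (Thm. 3.4), where (C₃) fixes `c₁`.

This file CLOSES the named fact `chernClassTheory_unique` (`TopologicalChernClasses`):

* `locLH_univ` — **the Leray–Hirsch theorem for `q : P(E) → B`** over an ARBITRARY paracompact
  Hausdorff base, for the family `1, a, …, aⁿ⁻¹` of powers of the pure class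
  `a = gaussClass C E ∈ H²(P(E); ℤ)` (`ProjectiveBundleGaussClass`): over the open subsets of the
  canonical charts by `isLHOn_chart` (`ProjectiveBundleLocalLH`, purity + the theorem for
  `U × ℂPⁿ⁻¹`, `ProjectiveLerayHirsch`), over Milnor's countable cover by disjoint unions of such
  sets (`Literature.Topology.exists_nat_cover_by_disjoint_subordinate`), and over the whole base by
  the band decomposition (`LerayHirschCovers.locLH_univ_of_nat_cover`) — Husemoller proves 1.1 for
  bundles of finite type and refers to a spectral sequence in general (Rem. 1.2); the band trick
  (Milnor–Stasheff §5) avoids it;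
* `injective_map_projMap` — **`q* : H*(B; ℤ) → H*(P(E); ℤ)` is injective** (the summand of `1`);
* `splitting_step` — the splitting datum of `chernClassTheory_unique_of_splitting` for every bundle
  of rank `≥ 2` (Prop. 5.2: `P(E)`, `q`, `λ_ξ`, `σ_ξ`, `q*ξ ≅ λ_ξ ⊕ σ_ξ` from
  `ProjectiveBundleSplittingIso`, and the injectivity);
* **`chernClassTheory_unique_holds : chernClassTheory_unique`** (the theory `C` quantified in the
  fact supplies the class `a = c₁^C`-pull-back used for the projective bundles).

Everything is proved; no named facts.

## References

* [HusemollerFibreBundles1994] D. Husemoller, *Fibre Bundles*, 3rd ed. (1994), Ch. 17 Thm. 5.4,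
  Prop. 5.2, Thm. 2.5, §1 Thm. 1.1 and Rem. 1.2, §3 Thm. 3.4.
* [MilnorStasheffAMS76] J. Milnor, J. Stasheff, *Characteristic Classes* (1974), §5 Lemma 5.9.
* [HatcherAT2002] A. Hatcher, *Algebraic Topology*, CUP 2002, Thm. 4D.1, §3.1.
-/

noncomputable section

-- as in `LerayHirschCovers`: chains of the concrete complex are `Finsupp`s up to unfolding of
-- semireducible definitions
set_option backward.isDefEq.respectTransparency false

open CategoryTheory Function Set Module Bundle Topology
open Literature.AlgebraicTopology.SingularHomology Literature.AlgebraicTopology.SingularHomology.subsetCochains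
  Literature.Topology.FourManifolds
open scoped LinearAlgebra.Projectivization

namespace Literature.AlgebraicTopology.CharacteristicClasses

open ComplexVectorBundle

/-- Local notation: the coefficient object `ULift ℤ` of `ModuleCat ℤ`. -/
local notation "𝑹" => SimplexSpan.coefR ℤ

section LH

variable {B : Type} [TopologicalSpace B] [T2Space B] [ParacompactSpace B] (C : ChernClassTheory)
  (E : ComplexVectorBundle.{0, 0} B)

/-- **Leray–Hirsch for `P(E) → B` hereditarily over the base sets of the canonical charts**
(the local theorem for a pure class, `isLHOn_chart`, with purity `map_projChartInv_gaussClass`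
and the fibre generator `span_refClass_eq_top`). [cite: HusemollerFibreBundles1994, Ch. 17 §1 Thm. 1.1, §2 Thm. 2.5] -/
theorem locLH_chart (hr : 2 ≤ E.rank) (b : B) :
    LHSubset.LocLH (R := ℤ) E.projMap (lhDeg E.rank) (powRep E.rank (gaussClass E C)) (powRep_d E.rank (gaussClass E C))
      (trivializationAt E.F E.E b).baseSet := fun U hU _ ↦
  isLHOn_chart E (trivializationAt E.F E.E b) U hU (by omega) rfl (gaussClass E C) (refClass E C)
    (span_refClass_eq_top E C hr) (map_projChartInv_gaussClass E C (trivializationAt E.F E.E b) U hU)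

/-- **The Leray–Hirsch theorem for the projective bundle `q : P(E) → B` over a paracompact
Hausdorff base** (`rank E ≥ 2`), hereditarily over the whole base: the comparison maps
`θ_U : ⊕_{k < n} H*⁻²ᵏ_B(U) → H*_{P(E)}(q⁻¹U)`, `θ(c) = Σ q*(c_k) ⌣ aᵏ`, are bijective for every open
`U ⊆ B` (Husemoller Ch. 17 §1 Thm. 1.1 with §2 Thm. 2.5; general base by Milnor's countable cover
by disjoint unions and the band decomposition). [cite: HusemollerFibreBundles1994, Ch. 17 §2 Thm. 2.5] -/
theorem locLH_univ (hr : 2 ≤ E.rank) :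
    LHSubset.LocLH (R := ℤ) E.projMap (lhDeg E.rank) (powRep E.rank (gaussClass E C)) (powRep_d E.rank (gaussClass E C))
      (univ : Set B) := by
  classical
  obtain ⟨W, hWo, hWsub, hWdis, hWcov⟩ := Literature.Topology.exists_nat_cover_by_disjoint_subordinate
    (fun b : B ↦ (trivializationAt E.F E.E b).baseSet) (fun b ↦ (trivializationAt E.F E.E b).open_baseSet)
    (eq_univ_of_forall fun b ↦ mem_iUnion.2 ⟨b, mem_baseSet_trivializationAt E.F E.E b⟩)
  refine LHSubset.locLH_univ_of_nat_cover E.projMap (lhDeg E.rank) _ _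
    (fun k ↦ ⋃ S ∈ {S : Finset B | S.card = k + 1}, W S) (fun k ↦ isOpen_biUnion fun S _ ↦ hWo S) hWcov fun k ↦ ?_
  -- each member of the cover is a disjoint union of subsets of chart base sets
  rw [biUnion_eq_iUnion]
  refine LHSubset.locLH_iUnion_of_disjoint E.projMap (lhDeg E.rank) _ _ (fun S : ↥{S : Finset B | S.card = k + 1} ↦ W S.1)
    (fun S ↦ hWo S.1) (fun S S' hSS' ↦ hWdis k S.2 S'.2 fun h ↦ hSS' (Subtype.ext h)) fun S ↦ ?_
  have hne : S.1.Nonempty := Finset.card_pos.1 (by have := S.2; change S.1.card = k + 1 at this; omega)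
  obtain ⟨b, hb⟩ := hWsub S.1 hne
  exact LHSubset.locLH_mono E.projMap (lhDeg E.rank) _ _ hb (locLH_chart C E hr b)

/-- The bottom index `(k, e) = (0, j)` of degree `j` (the summand of `1`). [folklore] -/
def bottomIdx (r j : ℕ) (hr : 0 < r) : LHSubset.Idx (lhDeg r) j := ⟨(⟨0, hr⟩, ⟨j, Nat.lt_succ_self j⟩), rfl⟩

/-- **`θ` of a source supported at the bottom index `(1, j)` is `q*`**: the representative of
`a⁰ = 1` is the constant cocycle `1`, which acts as the identity. [folklore] -/
theorem lhMap_single_bottom (hr : 2 ≤ E.rank) {U : Set B} {W : Set E.Proj} (hW : MapsTo E.projMap W U) (j : ℕ)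
    (y : (subsetCochains ℤ 𝑹 U).homology j) :
    LHSubset.lhMap E.projMap (lhDeg E.rank) (powRep E.rank (gaussClass E C)) (powRep_d E.rank (gaussClass E C)) U W hW j
        (Pi.single (bottomIdx E.rank j (by omega)) y) =
      pullH (N := 𝑹) E.projMap hW j y := by
  rw [LHSubset.lhMap_apply, Finset.sum_eq_single (bottomIdx E.rank j (by omega))]
  · rw [Pi.single_eq_same]
    have h1 : powRep E.rank (gaussClass E C) (bottomIdx E.rank j (by omega)).cls = cochainOne ℤ E.Proj :=
      funext fun τ ↦ powRep_zero E.rank (gaussClass E C) _ rfl τ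
    rw [LinearMap.congr_fun (cupRightH_congr_fun (SimplexSpan.ofSet (R := ℤ) W) (SimplexSpan.frontBackClosed_ofSet _) h1
      (powRep_d E.rank (gaussClass E C) _) (d_cochainOne ℤ) (bottomIdx E.rank j (by omega)).2) _]
    exact cupRightH_cochainOne W (d_cochainOne ℤ) (bottomIdx E.rank j (by omega)).2 _
  · intro s _ hs
    rw [Pi.single_eq_of_ne hs, map_zero, map_zero]
  · exact fun h ↦ absurd (Finset.mem_univ _) h

include C in
/-- **`q* : Hʲ(B; ℤ) → Hʲ(P(E); ℤ)` is injective for `rank E ≥ 2`** (Husemoller Ch. 17 Thm. 2.5: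
"`q*` is a monomorphism", the summand of `1` in the Leray–Hirsch decomposition).
[cite: HusemollerFibreBundles1994, Ch. 17 §2 Thm. 2.5] -/
theorem injective_map_projMap (hr : 2 ≤ E.rank) (j : ℕ) :
    Function.Injective (singularCohomology.map ℤ ℤ E.projMap j) := by
  have hLH := locLH_univ C E hr univ subset_rfl isOpen_univ
  have hθ := LHSubset.injective_of_isLHOn E.projMap (lhDeg E.rank) _ _ hLH j
  -- `q*` is injective on `H*_B(univ) → H*_{P(E)}(q⁻¹ univ)`
  have hpull : Function.Injective (pullH (N := 𝑹) E.projMap (mapsTo_preimage_left E.projMap (univ : Set B)) j) := by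
    intro y y' h
    have key : Pi.single (bottomIdx E.rank j (by omega)) y =
        (Pi.single (bottomIdx E.rank j (by omega)) y' : LHSubset.Src (R := ℤ) (lhDeg E.rank) (univ : Set B) j) :=
      hθ (by rw [lhMap_single_bottom C E hr, lhMap_single_bottom C E hr, h])
    have := congrFun key (bottomIdx E.rank j (by omega))
    rwa [Pi.single_eq_same, Pi.single_eq_same] at this
  -- transport through the comparison isomorphisms and `↥univ ≃ₜ -`
  let uX : ↥(E.projMap ⁻¹' (univ : Set B)) ≃ₜ E.Proj := Homeomorph.Set.univ E.Proj
  let uB : ↥(univ : Set B) ≃ₜ B := Homeomorph.Set.univ B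
  have hsq : E.projMap.comp (uX : C(↥(E.projMap ⁻¹' (univ : Set B)), E.Proj)) =
      (uB : C(↥(univ : Set B), B)).comp (restrictMap E.projMap (mapsTo_preimage_left E.projMap (univ : Set B))) :=
    ContinuousMap.ext fun _ ↦ rfl
  intro a a' haa'
  have eB := (ConcreteCategory.isIso_iff_bijective (singularCohomology.mapIso ℤ ℤ uB j).hom).1 inferInstance
  have eX := (ConcreteCategory.isIso_iff_bijective (singularCohomology.mapIso ℤ ℤ uX j).hom).1 inferInstance
  have eI := (ConcreteCategory.isIso_iff_bijective (homologyIsoSingularCohomology ℤ (univ : Set B) j).inv).1 inferInstance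
  apply eB.1
  -- the images in `H*(↥univ_B)` come from `H*_B(univ)`
  obtain ⟨y, hy⟩ := ((ConcreteCategory.isIso_iff_bijective (homologyIsoSingularCohomology ℤ (univ : Set B) j).hom).1
    inferInstance).2 (singularCohomology.map ℤ ℤ (uB : C(↥(univ : Set B), B)) j a)
  obtain ⟨y', hy'⟩ := ((ConcreteCategory.isIso_iff_bijective (homologyIsoSingularCohomology ℤ (univ : Set B) j).hom).1
    inferInstance).2 (singularCohomology.map ℤ ℤ (uB : C(↥(univ : Set B), B)) j a')
  change singularCohomology.map ℤ ℤ (uB : C(↥(univ : Set B), B)) j a = singularCohomology.map ℤ ℤ (uB : C(↥(univ : Set B), B)) j a'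
  rw [← hy, ← hy']
  congr 1
  apply hpull
  apply iso_injective
  rw [homologyIsoSingularCohomology_hom_pullH, homologyIsoSingularCohomology_hom_pullH, hy, hy', ← ModuleCat.comp_apply,
    ← singularCohomology.map_comp, ← ModuleCat.comp_apply, ← singularCohomology.map_comp, ← hsq,
    singularCohomology.map_comp, ModuleCat.comp_apply, ModuleCat.comp_apply, haa']

end LH

/-! ### The splitting step and the theorem -/

/-- **The splitting step** of the uniqueness proof for every bundle of rank `≥ 2` over a
paracompact Hausdorff base: the projective bundle `q : P(E) → B`, the canonical line bundle `λ`,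
the quotient `σ` with `q*E ≅ λ ⊕ σ` (Husemoller Prop. 5.2, `ComplexVectorBundle.splitIso`), and
`q*` injective on `H²ⁱ(-; ℤ)` (Thm. 2.5). [cite: HusemollerFibreBundles1994, Ch. 17 §5 Prop. 5.2, Thm. 2.5] -/
theorem splitting_step (C : ChernClassTheory) {B : Type} [TopologicalSpace B] [T2Space B] [ParacompactSpace B]
    (E : ComplexVectorBundle.{0, 0} B) (hE : 2 ≤ E.rank) :
    ∃ (B₁ : Type) (_ : TopologicalSpace B₁) (_ : T2Space B₁) (_ : ParacompactSpace B₁)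
      (f : C(B₁, B)) (L E' : ComplexVectorBundle.{0, 0} B₁),
      L.rank ≤ 1 ∧ E'.rank < E.rank ∧ Nonempty ((E.pullback f).Iso (L.directSum E')) ∧
        ∀ i, Function.Injective (singularCohomology.map ℤ ℤ f (2 * i)) := by
  obtain ⟨g⟩ := exists_gaussMap (𝕜 := ℂ) (F := E.F) (E := E.E)
    (id : B × Fin (Module.finrank ℂ E.F) → B × Fin (Module.finrank ℂ E.F)) injective_id
  let k₀ : Fin E.rank := ⟨0, by omega⟩
  refine ⟨E.Proj, inferInstance, inferInstance, inferInstance, E.projMap, E.lineBundle k₀, E.quotBundle k₀, ?_, ?_,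
    ⟨E.splitIso k₀ g⟩, fun i ↦ injective_map_projMap C E hE (2 * i)⟩
  · rw [E.rank_lineBundle k₀]
  · rw [rank_quotBundle]
    omega

/-- **Uniqueness of Chern classes** (Husemoller, *Fibre Bundles*, Ch. 17 Thm. 5.4: "The
properties (C₀) to (C₃) completely determine the Chern classes"): two theories of Chern classes
`C, C'` satisfying (C₀)–(C₃) with the same chosen generator `c₁(γ¹) ∈ H²(ℂP¹; ℤ)` agree on every
complex vector bundle over a paracompact Hausdorff base — the tree's named fact
`chernClassTheory_unique`, PROVED: the line-bundle case (`chernClass_eq_of_rank_le_one`, Ch. 17 §3)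
and the splitting principle (`chernClassTheory_unique_of_splitting`, Thm. 5.4's induction on the
rank) fed with the splitting step above (Prop. 5.2 and Thm. 2.5, the Leray–Hirsch theorem for the
projective bundle). [cite: HusemollerFibreBundles1994, Ch. 17 Thm. 5.4] -/
theorem chernClassTheory_unique_holds : chernClassTheory_unique := by
  intro C C' hCC' B _ _ _ E i
  exact chernClassTheory_unique_of_splitting (fun E' hE' ↦ splitting_step C E' hE') C C' hCC' E i

end Literature.AlgebraicTopology.CharacteristicClasses
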